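import Literature.AlgebraicTopology.SingularHomology.SuspensionIsomorphism
import Literature.AlgebraicTopology.Homotopy.IteratedSuspension
import HarnessLib

/-!
# The iterated suspension isomorphism and the stability of the Steenrod squares

Iterating `SuspensionIsomorphism.lean` along the `N`-fold unreduced suspension `suspN P N`
(`IteratedSuspension.lean`): for `P` nonempty and `k ≥ 1`,
`suspensionIsoN R M P k N : Hᵏ(P; M) ≅ Hᵏ⁺ᴺ(SᴺP; M)` (Hatcher, *Algebraic Topology* (2002), §2.1
Exercise 20, dualised and iterated), and the Steenrod squares commute with it,
`Σᴺ ∘ Sq_{n,i} = Sq_{n+N,i+N} ∘ Σᴺ`, i.e. `Σᴺ Sqʲ = Sqʲ Σᴺ` (Hatcher 2002, §4.L; Steenrod 1947,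
§7). Everything is proved; no named facts.

## References

* A. Hatcher, *Algebraic Topology*, CUP 2002, §2.1 Exercise 20, §4.L. [Hatcher2002]
* N. E. Steenrod, *Products of cocycles and extensions of mappings*, Ann. of Math. 48 (1947), §7.
  [Steenrod1947]
-/

noncomputable section

open CategoryTheory
open Literature.AlgebraicTopology.Homotopy

universe u v

namespace Literature.AlgebraicTopology.SingularHomology

variable (R : Type v) [CommRing R] (M : Type v) [AddCommGroup M] [Module R M]
variable (P : Type u) [TopologicalSpace P] [Nonempty P]

/-- **The iterated suspension isomorphism** `Hᵏ(P; M) ≅ Hᵏ⁺ᴺ(SᴺP; M)` for `k ≥ 1`, `P` nonempty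
(Hatcher 2002, §2.1 Exercise 20, iterated): `Σ⁰ = id`, `Σᴺ⁺¹ = Σ ∘ Σᴺ`. [cite: Hatcher2002, §2.1 Exercise 20] -/
def suspensionIsoN (k : ℕ) [NeZero k] :
    ∀ N : ℕ, singularCohomology R M P k ≅ singularCohomology R M (suspN P N) (k + N)
  | 0 => Iso.refl _
  | N + 1 =>
    haveI : NeZero (k + N) := ⟨by have := NeZero.ne k; omega⟩
    suspensionIsoN k N ≪≫ suspensionIso R M (suspN P N) (k + N)

/-- `Σ⁰ = id`. [folklore] -/
@[simp] lemma suspensionIsoN_zero (k : ℕ) [NeZero k] :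
    suspensionIsoN R M P k 0 = Iso.refl _ := rfl

/-- `Σᴺ⁺¹ = Σ ∘ Σᴺ`. [folklore] -/
lemma suspensionIsoN_succ (k : ℕ) [NeZero k] (N : ℕ) :
    suspensionIsoN R M P k (N + 1) =
      haveI : NeZero (k + N) := ⟨by have := NeZero.ne k; omega⟩
      suspensionIsoN R M P k N ≪≫ suspensionIso R M (suspN P N) (k + N) := rfl

variable {R} [CharP R 2]

/-- **`Sq` commutes with the iterated suspension isomorphism**: for `x ∈ Hᵖ(P; R)`, `p, n ≥ 1`,
`Σᴺ(Sq_{n,i} x) = Sq_{n+N,i+N}(Σᴺ x)` (Hatcher 2002, §4.L; Steenrod 1947, §7), by induction on `N`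
from `suspensionIso_steenrodSqLower`. [cite: Hatcher2002, §4.L] -/
theorem suspensionIsoN_steenrodSqLower {p : ℕ} [NeZero p] (n i : ℕ) [NeZero n]
    (x : singularCohomology R R P p) : ∀ N : ℕ,
    (suspensionIsoN R R P n N).hom (steenrodSqLower P p n i x) =
      steenrodSqLower (suspN P N) (p + N) (n + N) (i + N) ((suspensionIsoN R R P p N).hom x)
  | 0 => rfl
  | N + 1 => by
    haveI : NeZero (p + N) := ⟨by have := NeZero.ne p; omega⟩
    haveI : NeZero (n + N) := ⟨by have := NeZero.ne n; omega⟩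
    change (suspensionIso R R (suspN P N) (n + N)).hom
        ((suspensionIsoN R R P n N).hom (steenrodSqLower P p n i x)) =
      steenrodSqLower (Susp (suspN P N)) (p + N + 1) (n + N + 1) (i + N + 1)
        ((suspensionIso R R (suspN P N) (p + N)).hom ((suspensionIsoN R R P p N).hom x))
    rw [suspensionIsoN_steenrodSqLower n i x N]
    exact suspensionIso_steenrodSqLower (suspN P N) (n + N) (i + N) _

/-- **`Σᴺ Sqʲ = Sqʲ Σᴺ`** (upper indexing): for `x ∈ Hᵖ(P; R)`, `p ≥ 1`,
`Σᴺ(Sqʲ x) = Sq_{p+j+N, p-j+N}(Σᴺ x)`, the square `Sqʲ` of `Σᴺ x ∈ Hᵖ⁺ᴺ` landing in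
`H^{p+j+N}` (Hatcher 2002, §4.L). [cite: Hatcher2002, §4.L] -/
theorem suspensionIsoN_steenrodSq {p : ℕ} [NeZero p] (j : ℕ) (x : singularCohomology R R P p)
    (N : ℕ) :
    haveI : NeZero (p + j) := ⟨by have := NeZero.ne p; omega⟩
    (suspensionIsoN R R P (p + j) N).hom (steenrodSq P p j x) =
      steenrodSqLower (suspN P N) (p + N) (p + j + N) (p - j + N) ((suspensionIsoN R R P p N).hom x) :=
  suspensionIsoN_steenrodSqLower P (p + j) (p - j) x N

end Literature.AlgebraicTopology.SingularHomology
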